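import Summits.MatrixMultiplication.MatrixMultiplication.Theorems.AbelianSTPPCensusTAKnap575Rows
import Summits.MatrixMultiplication.MatrixMultiplication.Theorems.AbelianSTPPSieve
import Summits.MatrixMultiplication.MatrixMultiplication.Theorems.AbelianSTPPCensusThreeRoomEnergy

/-!
# T_A/575 certificate: soundness of the knapsack checker with the three-room energy clause

Cell mm-stpp (rung F-M1), T_A/575 = «no abelian STPP host of order `≤ 575` beats `τ = 2.371`»; design in the module docstring of
`AbelianSTPPCensusTAKnap575Defs.lean`; row domination and enumeration lemmas in `AbelianSTPPCensusTAKnap575Rows.lean`.  This file is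
`AbelianSTPPCensusTAKnap473Sound.lean` (seat theory g8, p471105; itself `…TAKnapSound.lean`, T_A/450, p463767) in the namespace `TAKnap575`
(universe `Mtop = 575`, `Bmax = 430`, gains `gainOf2371y` with the real-exponent bridge `ShapeCert.rpow_le_gain2371y` for `V ≤ 575`), with
the ONE new ingredient of this certificate:
* `sum_us_le_of_e3`: the shape-level E3 inequality of the maximal member `M·(V − σ) ≤ V²` (`2V > M`; `σ` the three U14⁺ slacks, exact
  because the three U14 rows give `V + S_X ≤ M`) is equivalent to the budget `S_A + S_B + S_C ≤ ⌊V²/M⌋ + 3M − 4V`;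
* `e3Adm_of_isSTPP`: every `IsSTPP` family with non-empty sets in a finite abelian group satisfies `TAKnap575.E3Adm` on its shape data —
  one application of `STPPThreeRoomEnergy.three_room_energy` (seat eng-2 g4, p490420) per member;
and otherwise VERBATIM:
* `inv_row0`, `inv_of_nil`, `inv_of_ne_nil`: the row invariant `Inv` along the volumes; `checkOrders_sound` (the order walk);
  `loopVR_sound` / `seg_sound` (a `true` segment evaluation certifies its volumes and hands the invariant to the next checkpoint);
* `sum_gain_le`: for a shape list that is `SieveAdmissible M` AND `E3Adm M` with `≥ 2` members at an order `M ≤ 575` all of whose volumes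
  are `Checked`, the member of maximal volume `l` plus the knapsack row bound `Σ_{i≠l} gainOf2371y(V_i) ≤ row_{V_l}[⌊cap/2⌋]` (budgets: the
  three U11-per-member rows at `l` give `2·Σ_i p_i ≤ 3M + s_l`, the three U14 rows at `l` give `Σ_{i≠l} p_i ≤ 3(M − V_l)`, and — new —
  E3 at `l` gives `Σ_{i≠l} p_i ≤ ⌊V_l²/M⌋ + 3M − 4V_l` when `2V_l > M`) yield `Σ_i gainOf2371y(V_i) ≤ 10⁶·M`;
* `not_beats_of_checked`: hence `¬ Beats (2371/1000) M` (`ShapeCert.rpow_le_gain2371y`).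
Statements spell the namespace `TAKnap575.` explicitly (the gate's landed-statement key is textual; these lemmas concern this file's
`Mtop = 575` objects, not the homonymous `TAKnap` / `TAKnap473` ones).
The segment evaluations are `…TAKnap575Eval*.lean`; the leaf is closed in `AbelianSTPPCensusLeafTA575Closed.lean`.
WHAT THIS IS NOT: no statement about STPP families beyond the consequences `SieveAdmissible` (vM) and `E3Adm` (E3); no bound on `ω`.
-/

set_option linter.dupNamespace false
set_option autoImplicit false

namespace Summit.MatrixMultiplication.MatrixMultiplication.Theorems.TAKnap575

open TECert (tableOK vol us tableOK_iff tableOK_mono)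
open ShapeCert (gainOf2371y D)

/-! ## The volume loop -/

/-- The zero row satisfies the invariant at volume `0` (no candidate has volume `0`). [bookkeeping] -/
theorem inv_row0 : TAKnap575.Inv 0 TAKnap575.row0 := by
  refine ⟨by simp [row0], fun G hG b hb hs => ?_⟩
  have : G = [] := by
    rcases G with _ | ⟨t, G⟩
    · rfl
    · obtain ⟨hc, hv⟩ := hG t List.mem_cons_self
      have := (cand_bounds hc).2.2
      omega
  subst this
  simp

/-- A volume without candidate shapes: the invariant passes from `V − 1` to `V` unchanged. [bookkeeping] -/
theorem inv_of_nil {V : ℕ} {row : List ℕ} (h : TAKnap575.triples V = []) (hInv : TAKnap575.Inv (V - 1) row) :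
    TAKnap575.Inv V row := by
  refine ⟨hInv.1, hInv.2.weaken fun t ht => ?_⟩
  obtain ⟨hc, hv⟩ := ht
  refine ⟨hc, ?_⟩
  rcases Nat.lt_or_ge (vol t) V with hlt | hge
  · omega
  · exfalso
    have hvt : vol t = V := le_antisymm hv hge
    have := mem_triples_of_cand hc
    rw [hvt, h] at this
    simp at this

/-- A volume with candidate shapes: inserting its item carries the invariant from `V − 1` to `V`. [bookkeeping] -/
theorem inv_of_ne_nil {V : ℕ} {row : List ℕ} (hV : 1 ≤ V) (hInv : TAKnap575.Inv (V - 1) row) :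
    TAKnap575.Inv V (TAKnap575.knapAdd (TAKnap575.pminL (TAKnap575.triples V) / 2) (gainOf2371y V) 10 1 row) := by
  have hU : 1 ≤ pminL (triples V) / 2 := by
    have : 3 ≤ pminL (triples V) :=
      le_minOver us (3 * Mtop) 3 (by simp [Mtop]) _ fun t ht => (cand_bounds (of_mem_triples ht).1).1
    omega
  obtain ⟨hlen, hdom⟩ := knapAdd_one_dom V _ hU row hInv.1 _ hInv.2
  refine ⟨hlen, hdom.weaken fun t ht => ?_⟩
  obtain ⟨hc, hv⟩ := ht
  rcases Nat.lt_or_ge (vol t) V with hlt | hge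
  · exact Or.inl ⟨hc, by omega⟩
  · have hvt : vol t = V := le_antisymm hv hge
    refine Or.inr ⟨hvt, Nat.div_le_div_right ?_⟩
    have := minOver_le us (3 * Mtop) (triples V) t (hvt ▸ mem_triples_of_cand hc)
    simpa [pminL] using this

/-- Soundness of the order walk: every order of the range passes against the full row. [bookkeeping] -/
theorem checkOrders_sound (V g d : ℕ) (rowV : List ℕ) : ∀ (n M pos : ℕ) (row : List ℕ), row = rowV.drop pos →
    TAKnap575.checkOrders V g d n M pos row = true →
      ∀ M', M ≤ M' → M' < M + n → g + rowV.getD (TAKnap575.cap M' V d / 2) 0 ≤ D * M'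
  | 0, M, pos, row, _, _, M', h1, h2 => by omega
  | n + 1, M, pos, row, hrow, h, M', h1, h2 => by
    have hunf : checkOrders V g d (n + 1) M pos row =
        ((Nat.ble pos (cap M V d / 2) && match row.drop (cap M V d / 2 - pos) with
          | [] => false
          | x :: _ => Nat.ble (g + x) (D * M)) &&
          checkOrders V g d n (M + 1) (cap M V d / 2) (row.drop (cap M V d / 2 - pos))) := rfl
    rw [hunf, Bool.and_eq_true, Bool.and_eq_true] at h
    obtain ⟨⟨hpos, hhead⟩, hrest⟩ := h
    have hposC : pos ≤ cap M V d / 2 := by simpa using hpos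
    have hdrop : row.drop (cap M V d / 2 - pos) = rowV.drop (cap M V d / 2) := by
      rw [hrow, List.drop_drop]
      congr 1; omega
    rcases Nat.eq_or_lt_of_le h1 with rfl | hlt
    · rw [hdrop] at hhead
      cases hD : rowV.drop (cap M V d / 2) with
      | nil => rw [hD] at hhead; exact absurd hhead (by simp)
      | cons x tl =>
        rw [hD] at hhead
        have hx : rowV.getD (cap M V d / 2) 0 = x := by
          rw [List.getD_eq_getElem?_getD, ← List.head?_drop, hD]; rfl
        rw [hx]
        simpa using hhead
    · exact checkOrders_sound V g d rowV n (M + 1) (cap M V d / 2) _ hdrop hrest M' hlt (by omega)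

/-- Soundness of the volume loop: from the invariant at `V − 1`, a `true` first component yields the invariant for the final row at
`V + k − 1` and the order checks for every volume of `[V, V + k)`. [bookkeeping] -/
theorem loopVR_sound (lo n : ℕ) : ∀ (k V : ℕ) (row : List ℕ), 1 ≤ V → TAKnap575.Inv (V - 1) row →
    (TAKnap575.loopVR lo n k V row).1 = true →
      TAKnap575.Inv (V + k - 1) (TAKnap575.loopVR lo n k V row).2 ∧ ∀ V', V ≤ V' → V' < V + k → TAKnap575.Checked lo n V'
  | 0, V, row, _, hInv, _ => ⟨by simpa [loopVR] using hInv, fun V' h1 h2 => by omega⟩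
  | k + 1, V, row, hV, hInv, h => by
    cases hT : triples V with
    | nil =>
      have hred : loopVR lo n (k + 1) V row = loopVR lo n k (V + 1) row := by
        simp [loopVR, hT]
      rw [hred] at h ⊢
      have hInv' : Inv (V + 1 - 1) row := by simpa using inv_of_nil hT hInv
      obtain ⟨h1, h2⟩ := loopVR_sound lo n k (V + 1) row (by omega) hInv' h
      refine ⟨by simpa [show V + 1 + k - 1 = V + (k + 1) - 1 by omega] using h1, fun V' hV' hlt => ?_⟩
      rcases Nat.eq_or_lt_of_le hV' with rfl | hlt'
      · intro hne; exact absurd hT hne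
      · exact h2 V' hlt' (by omega)
    | cons t ts =>
      set row' := knapAdd (pminL (triples V) / 2) (gainOf2371y V) 10 1 row with hrow'
      have hred : loopVR lo n (k + 1) V row =
          ((Nat.beq (rowSum row') (rowSum row') &&
              checkOrders V (gainOf2371y V) (dminL (triples V)) n lo 0 row') && (loopVR lo n k (V + 1) row').1,
            (loopVR lo n k (V + 1) row').2) := by
        simp only [loopVR, hT, hrow']
      rw [hred] at h ⊢
      simp only [Bool.and_eq_true] at h
      obtain ⟨⟨-, hchk⟩, hrec⟩ := h
      have hInv' : Inv V row' := inv_of_ne_nil hV hInv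
      obtain ⟨h1, h2⟩ := loopVR_sound lo n k (V + 1) row' (by omega) (by simpa using hInv') hrec
      refine ⟨by simpa [show V + 1 + k - 1 = V + (k + 1) - 1 by omega] using h1, fun V' hV' hlt => ?_⟩
      rcases Nat.eq_or_lt_of_le hV' with rfl | hlt'
      · intro _
        exact ⟨row', hInv', fun M hM1 hM2 =>
          checkOrders_sound V (gainOf2371y V) (dminL (triples V)) row' n lo 0 row' (by simp) hchk M hM1 hM2⟩
      · exact h2 V' hlt' (by omega)

/-- A segment certificate: from the invariant at `V − 1` for `rowA`, the kernel fact `loopVR lo n k V rowA = (true, rowB)` yields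
the invariant at `V + k − 1` for `rowB` and the order checks on `[V, V + k)`. [bookkeeping] -/
theorem seg_sound {lo n k V : ℕ} {rowA rowB : List ℕ} (hV : 1 ≤ V) (hA : TAKnap575.Inv (V - 1) rowA)
    (h : TAKnap575.loopVR lo n k V rowA = (true, rowB)) :
    TAKnap575.Inv (V + k - 1) rowB ∧ ∀ V', V ≤ V' → V' < V + k → TAKnap575.Checked lo n V' := by
  have h1 : (loopVR lo n k V rowA).1 = true := by rw [h]
  have h2 : (loopVR lo n k V rowA).2 = rowB := by rw [h]
  simpa [h2] using loopVR_sound lo n k V rowA hV hA h1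

/-! ## The new clause: E3 in shape form -/

/-- **E3 as a knapsack budget.**  If the three U14 rows of a member of volume `V` hold (`V + S_A ≤ M`, `V + S_B ≤ M`, `V + S_C ≤ M`),
`2V > M`, and the three-room energy inequality `M · (V − σ) ≤ V²` holds with `σ = (M − (V+S_A)) + (M − (V+S_B)) + (M − (V+S_C))`
(truncated, as in `STPPThreeRoomEnergy.false_of_energy3`), then `S_A + S_B + S_C ≤ ⌊V²/M⌋ + 3M − 4V` (truncated).  The converse also
holds; only this direction is used. [original] -/
theorem sum_us_le_of_e3 {M V SA SB SC : ℕ} (hA : V + SA ≤ M) (hB : V + SB ≤ M) (hC : V + SC ≤ M) (h2 : M < 2 * V)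
    (hE : M * (V - ((M - (V + SA)) + (M - (V + SB)) + (M - (V + SC)))) ≤ V ^ 2) :
    SA + SB + SC ≤ (V * V / M + 3 * M) - 4 * V := by
  have hM : 0 < M := by omega
  set q := V * V / M with hq
  have hle : V - ((M - (V + SA)) + (M - (V + SB)) + (M - (V + SC))) ≤ q := by
    rw [hq, Nat.le_div_iff_mul_le hM, ← pow_two]
    rw [mul_comm] at hE
    exact hE
  omega

/-- **E3 holds on the shape data of every STPP family** (finite abelian host, all sets non-empty): `TAKnap575.E3Adm |H| (|A_i|) (|B_i|) (|C_i|)`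
— for each member `t` with `2V_t > |H|` this is `STPPThreeRoomEnergy.three_room_energy` (p490420) with the exact U14⁺ slacks
`s_X = |H| − (V_t + S_X)`. [original] -/
theorem e3Adm_of_isSTPP {H : Type} [AddCommGroup H] [Fintype H] [DecidableEq H] {N : ℕ} {A B C : Fin N → Finset H}
    (hS : Literature.Computability.AlgebraicComplexity.IsSTPP A B C)
    (hne : ∀ i, (A i).Nonempty ∧ (B i).Nonempty ∧ (C i).Nonempty) :
    TAKnap575.E3Adm (Fintype.card H) (fun i => (A i).card) (fun i => (B i).card) (fun i => (C i).card) := by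
  intro t h2
  dsimp only at h2 ⊢
  exact STPPThreeRoomEnergy.three_room_energy hS (fun u => (hne u).1) (fun u => (hne u).2.1) (fun u => (hne u).2.2) t
    _ _ _ (by omega) (by omega) (by omega) h2

/-! ## From the certificate to shape lists: the maximal member and the three budgets -/

/-- **Arithmetic core.** If every volume `1 … Mtop` is `Checked` for the orders `lo … lo+n−1`, then every shape list that is
`SieveAdmissible M` and `E3Adm M`, with at least two members, at such an order `M ≤ Mtop`, has `Σ_i gainOf2371y (a_i b_i c_i) ≤ 10⁶ · M`.
[original] -/
theorem sum_gain_le {lo n : ℕ} (hall : ∀ V, 1 ≤ V → V ≤ TAKnap575.Mtop → TAKnap575.Checked lo n V) {N M : ℕ}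
    {a b c : Fin N → ℕ} (hN : 2 ≤ N) (hlo : lo ≤ M) (hhi : M < lo + n) (hM : M ≤ TAKnap575.Mtop)
    (hS : SieveAdmissible M a b c) (hE : TAKnap575.E3Adm M a b c) :
    ∑ i, gainOf2371y (a i * b i * c i) ≤ D * M := by
  classical
  obtain ⟨h1, h2, -, h4, h5, h6, -⟩ := hS
  haveI : Nontrivial (Fin N) := Fin.nontrivial_iff_two_le.mpr hN
  -- every member is a candidate (table at order `M ≤ Mtop`)
  have hcand : ∀ i, Cand (a i, b i, c i) := by
    intro i
    obtain ⟨ha, hb, hc, hV⟩ := h1 i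
    obtain ⟨n1, n2, n3⟩ := h2 i
    obtain ⟨j, hj⟩ := exists_ne i
    obtain ⟨u1, u2, u3, -⟩ := h5 i j hj.symm
    refine ⟨ha, hb, hc, tableOK_mono ((tableOK_iff _ _ _ _).mpr ⟨?_, n1, n2, n3, ?_, ?_, ?_⟩) hM⟩ <;>
      simp only [shapeVol] at hV u1 u2 u3 ⊢ <;> omega
  -- the member of maximal volume
  obtain ⟨l, -, hl⟩ := Finset.exists_max_image Finset.univ (fun i => a i * b i * c i)
    ⟨⟨0, by omega⟩, Finset.mem_univ _⟩
  set Vl := a l * b l * c l with hVl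
  have hVl1 : 1 ≤ Vl := (cand_bounds (hcand l)).2.2
  have hVlM : Vl ≤ M := by have := (h1 l).2.2.2; simpa [shapeVol] using this
  have hmem : (a l, b l, c l) ∈ triples Vl := mem_triples_of_cand (hcand l)
  have hne : triples Vl ≠ [] := fun h => by rw [h] at hmem; simp at hmem
  obtain ⟨row, ⟨hlen, hdom⟩, hrow⟩ := hall Vl hVl1 (hVlM.trans hM) hne
  -- the other members, as a list of shapes
  set G : List (ℕ × ℕ × ℕ) := ((Finset.univ.erase l).toList).map fun j => (a j, b j, c j) with hG
  have hGcov : ∀ t ∈ G, Cov Vl t := by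
    intro t ht
    rw [hG, List.mem_map] at ht
    obtain ⟨j, -, rfl⟩ := ht
    exact ⟨hcand j, hl j (Finset.mem_univ j)⟩
  have hGw : (G.map fun t => us t / 2).sum = ∑ j ∈ Finset.univ.erase l, (a j * b j + b j * c j + c j * a j) / 2 := by
    rw [hG, List.map_map, Finset.sum_map_toList]; rfl
  have hGv : (G.map fun t => gainOf2371y (vol t)).sum = ∑ j ∈ Finset.univ.erase l, gainOf2371y (a j * b j * c j) := by
    rw [hG, List.map_map, Finset.sum_map_toList]; rfl
  -- budget (i): the three U11 rows at `l`
  obtain ⟨hA, hB, hC⟩ := h4 l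
  have e2 : (∑ j, a j * (b j + c j)) + (∑ j, b j * (c j + a j)) + ∑ j, c j * (a j + b j) =
      2 * ∑ j, (a j * b j + b j * c j + c j * a j) := by
    rw [Finset.mul_sum, ← Finset.sum_add_distrib, ← Finset.sum_add_distrib]
    exact Finset.sum_congr rfl fun j _ => by ring
  have esplit : ∑ j, (a j * b j + b j * c j + c j * a j) =
      (a l * b l + b l * c l + c l * a l) + ∑ j ∈ Finset.univ.erase l, (a j * b j + b j * c j + c j * a j) :=
    (Finset.add_sum_erase _ _ (Finset.mem_univ l)).symm
  have hdmin : dminL (triples Vl) ≤ 2 * (a l * b l + b l * c l + c l * a l) - (a l + b l + c l) := by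
    have := minOver_le dd (3 * Mtop) (triples Vl) _ hmem
    simpa [dminL, dd, us, TECert.uu, TECert.vv, TECert.ww] using this
  have hdd : 3 ≤ 2 * (a l * b l + b l * c l + c l * a l) - (a l + b l + c l) := by
    have := (cand_bounds (hcand l)).2.1
    simpa [dd, us, TECert.uu, TECert.vv, TECert.ww] using this
  have hsum1 : 2 * ∑ j ∈ Finset.univ.erase l, (a j * b j + b j * c j + c j * a j) ≤ 3 * M - dminL (triples Vl) := by
    omega
  -- budget (ii): the three U14 rows at `l`
  obtain ⟨hab, -, hbc, -, hca, -⟩ := h6 l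
  simp only [u14Sum, shapeVol] at hab hbc hca
  have hsum2 : ∑ j ∈ Finset.univ.erase l, (a j * b j + b j * c j + c j * a j) ≤ 3 * (M - Vl) := by
    rw [Finset.sum_add_distrib, Finset.sum_add_distrib]; omega
  -- budget (iii): the three-room energy clause at `l` (only when `2·V_l > M`)
  have hsplit : ∑ j ∈ Finset.univ.erase l, (a j * b j + b j * c j + c j * a j) =
      (∑ j ∈ Finset.univ.erase l, a j * b j) + (∑ j ∈ Finset.univ.erase l, b j * c j) +
        ∑ j ∈ Finset.univ.erase l, c j * a j := by
    rw [Finset.sum_add_distrib, Finset.sum_add_distrib]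
  have hcap : ∑ j ∈ Finset.univ.erase l, (a j * b j + b j * c j + c j * a j) ≤ cap M Vl (dminL (triples Vl)) := by
    by_cases h2V : M < 2 * Vl
    · have hE3 := hE l h2V
      rw [← hVl] at hE3
      have he := sum_us_le_of_e3 (by omega) (by omega) (by omega) h2V hE3
      set q := Vl * Vl / M with hq
      simp only [cap, if_pos h2V]
      omega
    · simp only [cap, if_neg h2V]; omega
  -- halved weights
  have hw : (G.map fun t => us t / 2).sum ≤ cap M Vl (dminL (triples Vl)) / 2 := by
    rw [hGw, Nat.le_div_iff_mul_le (by norm_num)]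
    calc (∑ j ∈ Finset.univ.erase l, (a j * b j + b j * c j + c j * a j) / 2) * 2
        = ∑ j ∈ Finset.univ.erase l, (a j * b j + b j * c j + c j * a j) / 2 * 2 := Finset.sum_mul _ _ _
      _ ≤ ∑ j ∈ Finset.univ.erase l, (a j * b j + b j * c j + c j * a j) :=
          Finset.sum_le_sum fun j _ => Nat.div_mul_le_self _ _
      _ ≤ _ := hcap
  have hd3 : 3 ≤ dminL (triples Vl) :=
    le_minOver dd (3 * Mtop) 3 (by simp [Mtop]) _ fun t ht => (cand_bounds (of_mem_triples ht).1).2.1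
  have hb : cap M Vl (dminL (triples Vl)) / 2 ≤ Bmax := by
    have hcx : cap M Vl (dminL (triples Vl)) ≤ (3 * M - dminL (triples Vl)) / 2 := by
      simp only [cap]; split <;> omega
    simp only [Bmax, Mtop] at *; omega
  have hval := hdom G hGcov _ hb hw
  rw [hGv] at hval
  rw [← Finset.add_sum_erase _ _ (Finset.mem_univ l)]
  have hg : gainOf2371y (a l * b l * c l) = gainOf2371y Vl := by rw [hVl]
  rw [hg]
  have := hrow M hlo hhi
  omega

/-- **The certificate excludes beating.** Under the hypothesis of `sum_gain_le`, no shape list that is `SieveAdmissible M` and `E3Adm M`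
with at least two members at an order `M` of the range (`M ≤ 575`) beats `τ = 2371/1000`: `Σ V_i^{τ/3} ≤ Σ gainOf2371y(V_i)/10⁶ ≤ M`
(`ShapeCert.rpow_le_gain2371y`). [original] -/
theorem not_beats_of_checked {lo n : ℕ} (hall : ∀ V, 1 ≤ V → V ≤ TAKnap575.Mtop → TAKnap575.Checked lo n V)
    {N M : ℕ} {a b c : Fin N → ℕ} (hN : 2 ≤ N) (hlo : lo ≤ M) (hhi : M < lo + n) (hM : M ≤ TAKnap575.Mtop)
    (hS : SieveAdmissible M a b c) (hE : TAKnap575.E3Adm M a b c) : ¬ Beats (2371 / 1000) M a b c := by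
  have hsum := sum_gain_le hall hN hlo hhi hM hS hE
  have hV : ∀ i, a i * b i * c i ≤ 575 := fun i => by
    have := (hS.1 i).2.2.2; simp only [shapeVol] at this; simp only [Mtop] at hM; omega
  unfold Beats
  simp only [shapeVol, not_lt]
  have hle : ∑ i, ((a i * b i * c i : ℕ) : ℝ) ^ ((2371 / 1000 : ℝ) / 3) ≤
      ∑ i, (gainOf2371y (a i * b i * c i) : ℝ) / 1000000 :=
    Finset.sum_le_sum fun i _ => ShapeCert.rpow_le_gain2371y _ (hV i)
  rw [← Finset.sum_div] at hle
  refine hle.trans ?_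
  rw [div_le_iff₀ (by norm_num)]
  have h2 : ((∑ i, gainOf2371y (a i * b i * c i) : ℕ) : ℝ) ≤ ((D * M : ℕ) : ℝ) := by exact_mod_cast hsum
  push_cast at h2
  simpa [D, mul_comm] using h2

end Summit.MatrixMultiplication.MatrixMultiplication.Theorems.TAKnap575
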